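import Mathlib
import Literature.NumberTheory.DiophantineApproximation.KoksmaInequality
import HarnessLib

/-!
# The Koksma–Hlawka inequality in dimension two (Hlawka 1961; Zaremba's identity)

Topic `Literature/NumberTheory/DiophantineApproximation`; PROVED theorems (no named fact).
Companion of `KoksmaInequality` (`Discrepancy.koksma`, dimension one, `C¹` form) and
`KoksmaInequalityBV` (dimension one, bounded variation).  This file is the first
multidimensional case, `s = 2`, for integrands with continuous mixed partial derivatives —
the form in which the inequality is stated and proved in
[cite: DickPillichshammer2010, Prop. 2.18] via **Hlawka's identity** (also called **Zaremba's
identity**) [cite: DickPillichshammer2010, Prop. 2.17]: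

*Proposition 2.17 (Hlawka's identity).* `Q_N(f) − I(f) = Σ_{∅ ≠ u ⊆ {1,…,s}} (−1)^{|u|}
∫_{[0,1]^{|u|}} (∂^{|u|} f/∂x_u)(x_u, 1) Δ_P(x_u, 1) dx_u`, where
`Δ_P(x) = #{n : x_n ∈ [0, x)}/N − x_1 ⋯ x_s` is the local discrepancy of the point set `P`.

*Proposition 2.18 (Koksma–Hlawka inequality).* For `f : [0,1]^s → ℝ` all of whose mixed partial
derivatives are continuous on `[0,1]^s`,
`|I(f) − Q_N(f)| ≤ D*_N(P) · Σ_{∅ ≠ u} ∫_{[0,1]^{|u|}} |(∂^{|u|} f/∂x_u)(x_u, 1)| dx_u`,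
`D*_N(P) = sup_{x ∈ [0,1]^s} |Δ_P(x)|` the star discrepancy.

The right-hand factor is the variation of `f` on `[0,1]^s` in the sense of Hardy and Krause
`V(f) = Σ_{k=1}^s Σ_{i_1<⋯<i_k} V^{(k)}(f; i_1,…,i_k)` whenever the mixed partials are continuous
([cite: Niederreiter1992, Thm 2.11 and eq. (2.5)]: `V^{(s)}(f) = ∫_{[0,1]^s} |∂^s f/∂u_1⋯∂u_s|`,
the lower-order terms being the Vitali variations of the restrictions of `f` to the faces
`u_j = 1`), so for such `f` this is exactly **Theorem 2.11** of Niederreiter 1992 (= Hlawka's theorem,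
his ref. [134]): `|(1/N) Σ_n f(x_n) − ∫ f| ≤ V(f) D*_N(x_1,…,x_N)` for `x_n ∈ [0,1)^s`.

## What is formalised (dimension `s = 2`)

Points `(x_n, y_n) ∈ [0,1)²`, `n < N`, `N ≥ 1`; the counting function
`countLT₂ x y s t = #{n : x_n < s ∧ y_n < t}` of the anchored box `[0,s) × [0,t)` and the local
discrepancy `delta₂ x y s t = countLT₂/N − s t`; on the edges `t = 1`, `s = 1` it restricts to the
one-dimensional `Discrepancy.delta` of the LeVeque/Koksma files (private lemmas
`delta₂_one_right`, `delta₂_one_left`), which is how the edge terms are stated below; the star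
discrepancy `starDiscrepancy₂ x y = sup_{[0,1]²} |Δ|` with `0 ≤ D*_N ≤ 1`
(`starDiscrepancy₂_nonneg`, `starDiscrepancy₂_le_one`, `abs_delta₂_le_starDiscrepancy₂`).  The integrand is given with its partial derivatives as a family
`f, f₁ = ∂f/∂s, f₂ = ∂f/∂t on the edge s = 1, f₁₂ = ∂²f/∂t∂s` (`HasDerivAt` hypotheses on
`[0,1]²`, all four continuous on the square), exactly the data `(∂^{|u|}f/∂x_u)(x_u, 1)`,
`u = {1}, {2}, {1,2}`, entering Propositions 2.17/2.18.

* `hlawka_zaremba_identity₂` (Prop. 2.17, `s = 2`):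
  `(1/N) Σ_n f(x_n,y_n) − ∫₀¹∫₀¹ f = −∫₀¹ Δ(s,1) f₁(s,1) ds − ∫₀¹ Δ(1,t) f₂(t) dt
     + ∫₀¹∫₀¹ Δ(s,t) f₁₂(s,t) dt ds`.
* `koksma_hlawka₂` (Prop. 2.18 / Niederreiter Thm 2.11, `s = 2`): if `|Δ(s,t)| ≤ D` on `[0,1]²`
  then `|(1/N) Σ_n f(x_n,y_n) − ∫₀¹∫₀¹ f| ≤ D · (∫₀¹|f₁(s,1)| ds + ∫₀¹|f₂(t)| dt + ∫₀¹∫₀¹|f₁₂|)`,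
  the bracket being `V_HK(f)` for such `f`.
* `koksma_hlawka₂_starDiscrepancy₂`: the same with `D = starDiscrepancy₂ x y = sup_{[0,1]²} |Δ|`
  (`D*_N`), the literal shape of Theorem 2.11.

Proof (loc. cit.): for one point, the fundamental theorem of calculus applied in each variable
gives `f(x,y) = f(1,1) − ∫ₓ¹ f₁(s,1) ds − ∫_y¹ f₂(t) dt + ∫ₓ¹∫_y¹ f₁₂(s,t) dt ds`; averaging over the
points turns the indicators `1[x_n < s] 1[y_n < t]` into `countLT₂/N`; for the integral the same
expansion holds with `s`, `t`, `s t` in place of the indicators (two integrations by parts and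
Fubini on the square for the continuous integrands `f` and `s f₁(s,t)`); subtracting gives the
identity, and `|Δ| ≤ D` gives the inequality.

Not formalised here: dimension `s ≥ 3` (the same identity over all `2^s − 1` faces), and the
Hardy–Krause bounded-variation generality of Hlawka's theorem (no derivatives).

## References

* J. Dick, F. Pillichshammer, *Digital Nets and Sequences*, Cambridge Univ. Press 2010, §2.4,
  Proposition 2.17 (Hlawka's identity / Zaremba's identity) and Proposition 2.18 (Koksma–Hlawka
  inequality), Remark 2.19. [cite: DickPillichshammer2010, Prop. 2.17–2.18]
* H. Niederreiter, *Random Number Generation and Quasi-Monte Carlo Methods*, CBMS-NSF 63, SIAM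
  1992, Theorem 2.11 and eq. (2.5). [cite: Niederreiter1992, Thm 2.11]
* E. Hlawka, *Funktionen von beschränkter Variation in der Theorie der Gleichverteilung*,
  Ann. Mat. Pura Appl. 54 (1961) 325–333 (the original, general `s`, Hardy–Krause variation).
* S. K. Zaremba, *Some applications of multidimensional integration by parts*,
  Ann. Polon. Math. 21 (1968) 85–96 (the identity).
* L. Kuipers, H. Niederreiter, *Uniform Distribution of Sequences*, Wiley 1974, Ch. 2 §5,
  Theorem 5.5. [cite: KuipersNiederreiter1974, Ch. 2 Thm 5.5]

AI-produced formalisation (H21 engines group, seat eng-quad-3, 2026-08-21); no facts, no axioms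
beyond Mathlib's, no `sorry`.
-/

noncomputable section

namespace Literature.NumberTheory.DiophantineApproximation

namespace Discrepancy

open MeasureTheory Set intervalIntegral Function

variable {N : ℕ}

/-! ### The two-dimensional counting function and local discrepancy -/

/-- `#{n : x_n < s ∧ y_n < t}`, the number of points `(x_n, y_n)` in the anchored half-open box
`[0, s) × [0, t)` (for points of `[0,1)²`). [folklore] -/
def countLT₂ (x y : Fin N → ℝ) (s t : ℝ) : ℕ :=
  (Finset.univ.filter fun n => x n < s ∧ y n < t).card

/-- The two-dimensional local discrepancy `Δ(s, t) = #{n : x_n < s, y_n < t}/N − s·t`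
(Dick–Pillichshammer's `Δ_P(s, t)`; Niederreiter's `A([0,s)×[0,t); P)/N − λ₂([0,s)×[0,t))`).
[cite: DickPillichshammer2010, §2.4 Prop. 2.17] -/
def delta₂ (x y : Fin N → ℝ) (s t : ℝ) : ℝ := (countLT₂ x y s t : ℝ) / N - s * t

/-- The two-dimensional star discrepancy `D*_N = sup_{(s,t) ∈ [0,1]²} |Δ(s, t)|` of the points
`(x_n, y_n)`. [cite: DickPillichshammer2010, Def. 2.14; Niederreiter1992, Def. 2.1] -/
def starDiscrepancy₂ (x y : Fin N → ℝ) : ℝ :=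
  sSup ((fun p : ℝ × ℝ => |delta₂ x y p.1 p.2|) '' (Icc (0 : ℝ) 1 ×ˢ Icc (0 : ℝ) 1))

variable (x y : Fin N → ℝ)

/-- The counting function as a sum of products of indicators. [folklore] -/
private theorem countLT₂_eq_sum (s t : ℝ) :
    (countLT₂ x y s t : ℝ) =
      ∑ n, (if x n < s then (1 : ℝ) else 0) * (if y n < t then (1 : ℝ) else 0) := by
  unfold countLT₂
  rw [Finset.card_filter]
  push_cast
  refine Finset.sum_congr rfl fun n _ => ?_
  by_cases h1 : x n < s <;> by_cases h2 : y n < t <;> simp [h1, h2]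

/-- `#{n : x_n < s, y_n < t} ≤ N`. [folklore] -/
private theorem countLT₂_le (s t : ℝ) : countLT₂ x y s t ≤ N :=
  (Finset.card_le_univ _).trans (by simp)

/-- On the edge `t ≥ 1` (all `y_n < 1`) the box count is the one-dimensional count of the `x_n`.
[folklore] -/
private theorem countLT₂_eq_countLT_left {y : Fin N → ℝ} (hy1 : ∀ n, y n < 1) (x : Fin N → ℝ) (s : ℝ)
    {t : ℝ} (ht : 1 ≤ t) : countLT₂ x y s t = countLT x s := by
  unfold countLT₂ countLT
  congr 1
  ext n
  simp only [Finset.mem_filter, Finset.mem_univ, true_and, and_iff_left_iff_imp]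
  exact fun _ => (hy1 n).trans_le ht

/-- On the edge `s ≥ 1` (all `x_n < 1`) the box count is the one-dimensional count of the `y_n`.
[folklore] -/
private theorem countLT₂_eq_countLT_right {x : Fin N → ℝ} (hx1 : ∀ n, x n < 1) (y : Fin N → ℝ) {s : ℝ}
    (hs : 1 ≤ s) (t : ℝ) : countLT₂ x y s t = countLT y t := by
  unfold countLT₂ countLT
  congr 1
  ext n
  simp only [Finset.mem_filter, Finset.mem_univ, true_and, and_iff_right_iff_imp]
  exact fun _ => (hx1 n).trans_le hs

/-- `Δ(s, 1) = Δ₁(s)`, the one-dimensional local discrepancy of the first coordinates.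
[folklore] -/
private theorem delta₂_one_right {y : Fin N → ℝ} (hy1 : ∀ n, y n < 1) (x : Fin N → ℝ) (s : ℝ) :
    delta₂ x y s 1 = delta x s := by
  rw [delta₂, delta, countLT₂_eq_countLT_left hy1 x s le_rfl, mul_one]

/-- `Δ(1, t) = Δ₂(t)`, the one-dimensional local discrepancy of the second coordinates.
[folklore] -/
private theorem delta₂_one_left {x : Fin N → ℝ} (hx1 : ∀ n, x n < 1) (y : Fin N → ℝ) (t : ℝ) :
    delta₂ x y 1 t = delta y t := by
  rw [delta₂, delta, countLT₂_eq_countLT_right hx1 y le_rfl t, one_mul]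

/-- `|Δ(s, t)| ≤ 1` on the unit square. [folklore] -/
private theorem abs_delta₂_le_one {s t : ℝ} (hs : s ∈ Icc (0 : ℝ) 1) (ht : t ∈ Icc (0 : ℝ) 1) :
    |delta₂ x y s t| ≤ 1 := by
  unfold delta₂
  have h1 : 0 ≤ (countLT₂ x y s t : ℝ) / N := by positivity
  have h2 : (countLT₂ x y s t : ℝ) / N ≤ 1 := by
    rcases Nat.eq_zero_or_pos N with hN | hN
    · subst hN; simp
    · rw [div_le_one (by exact_mod_cast hN)]
      exact_mod_cast countLT₂_le x y s t
  have h3 : 0 ≤ s * t := mul_nonneg hs.1 ht.1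
  have h4 : s * t ≤ 1 := mul_le_one₀ hs.2 ht.1 ht.2
  rw [abs_le]
  constructor <;> linarith

/-- The defining set of the star discrepancy is bounded above (by `1`). [folklore] -/
private theorem bddAbove_abs_delta₂ :
    BddAbove ((fun p : ℝ × ℝ => |delta₂ x y p.1 p.2|) '' (Icc (0 : ℝ) 1 ×ˢ Icc (0 : ℝ) 1)) := by
  refine ⟨1, ?_⟩
  rintro _ ⟨⟨s, t⟩, ⟨hs, ht⟩, rfl⟩
  exact abs_delta₂_le_one x y hs ht

/-- `|Δ(s, t)| ≤ D*_N` on the unit square (the star discrepancy is the supremum of `|Δ|` over the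
anchored boxes). [cite: Niederreiter1992, Def. 2.1; DickPillichshammer2010, Def. 2.14] -/
theorem abs_delta₂_le_starDiscrepancy₂ {s t : ℝ} (hs : s ∈ Icc (0 : ℝ) 1) (ht : t ∈ Icc (0 : ℝ) 1) :
    |delta₂ x y s t| ≤ starDiscrepancy₂ x y :=
  le_csSup (bddAbove_abs_delta₂ x y) ⟨(s, t), ⟨hs, ht⟩, rfl⟩

/-- `0 ≤ D*_N`: "Note that `0 ≤ D_N(𝓑; P) ≤ 1` always" [cite: Niederreiter1992, §2.1, remark
before Def. 2.1 (p. 14)]. [cite: Niederreiter1992, §2.1 p. 14] -/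
theorem starDiscrepancy₂_nonneg : 0 ≤ starDiscrepancy₂ x y :=
  (abs_nonneg _).trans
    (abs_delta₂_le_starDiscrepancy₂ x y ⟨le_rfl, zero_le_one⟩ ⟨le_rfl, zero_le_one⟩)

/-- `D*_N ≤ 1`: "Note that `0 ≤ D_N(𝓑; P) ≤ 1` always" [cite: Niederreiter1992, §2.1, remark
before Def. 2.1 (p. 14)]. [cite: Niederreiter1992, §2.1 p. 14] -/
theorem starDiscrepancy₂_le_one : starDiscrepancy₂ x y ≤ 1 :=
  csSup_le ⟨_, ⟨((0 : ℝ), (0 : ℝ)), ⟨⟨le_rfl, zero_le_one⟩, ⟨le_rfl, zero_le_one⟩⟩, rfl⟩⟩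
    (by rintro _ ⟨⟨s, t⟩, ⟨hs, ht⟩, rfl⟩; exact abs_delta₂_le_one x y hs ht)

/-! ### Symmetry and the indicator expansion of `Δ` -/

/-- `#{x_n < s, y_n < t} = #{y_n < t, x_n < s}`. [folklore] -/
private theorem countLT₂_comm (s t : ℝ) : countLT₂ x y s t = countLT₂ y x t s := by
  unfold countLT₂
  congr 1
  ext n
  simp only [Finset.mem_filter, Finset.mem_univ, true_and, and_comm]

/-- `Δ_{x,y}(s, t) = Δ_{y,x}(t, s)`. [folklore] -/
private theorem delta₂_comm (s t : ℝ) : delta₂ x y s t = delta₂ y x t s := by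
  rw [delta₂, delta₂, countLT₂_comm, mul_comm]

/-- `Δ(s, t) = (Σ_n 1[x_n < s] 1[y_n < t])/N − s t`. [folklore] -/
private theorem delta₂_eq_sum (s t : ℝ) :
    delta₂ x y s t =
      (∑ n, (if x n < s then (1 : ℝ) else 0) * (if y n < t then (1 : ℝ) else 0)) / N - s * t := by
  rw [delta₂, countLT₂_eq_sum]

/-- The indicator `1[c < t]` is interval integrable. [folklore] -/
private theorem intervalIntegrable_indicator_lt (c a b : ℝ) :
    IntervalIntegrable (fun t => if c < t then (1 : ℝ) else 0) volume a b := by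
  have h : (fun t => if c < t then (1 : ℝ) else 0) = (Ioi c).indicator fun _ => (1 : ℝ) := by
    funext t
    simp only [indicator, mem_Ioi]
  rw [h, intervalIntegrable_iff]
  exact (intervalIntegrable_iff.mp intervalIntegrable_const).indicator measurableSet_Ioi

/-- `t ↦ Δ(s, t)` is interval integrable on `[0, 1]`. [folklore] -/
private theorem intervalIntegrable_delta₂_right (s : ℝ) :
    IntervalIntegrable (fun t => delta₂ x y s t) volume 0 1 := by
  have h : (fun t => delta₂ x y s t) = fun t =>
      (∑ n, (if x n < s then (1 : ℝ) else 0) * (if y n < t then (1 : ℝ) else 0)) / N - s * t := by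
    funext t
    exact delta₂_eq_sum x y s t
  rw [h]
  refine IntervalIntegrable.sub (IntervalIntegrable.div_const ?_ _)
    (intervalIntegral.intervalIntegrable_id.const_mul s)
  have := IntervalIntegrable.sum Finset.univ fun n (_ : n ∈ Finset.univ) =>
    (intervalIntegrable_indicator_lt (y n) 0 1).const_mul (if x n < s then (1 : ℝ) else 0)
  exact this.congr fun t _ => Finset.sum_apply t _ _

/-- `s ↦ Δ(s, t)` is interval integrable on `[0, 1]`. [folklore] -/
private theorem intervalIntegrable_delta₂_left (t : ℝ) :
    IntervalIntegrable (fun s => delta₂ x y s t) volume 0 1 := by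
  have h : (fun s => delta₂ x y s t) = fun s => delta₂ y x t s := by
    funext s
    exact delta₂_comm x y s t
  rw [h]
  exact intervalIntegrable_delta₂_right y x t

/-! ### Calculus on the unit square

Elementary tools for functions continuous on `[0,1]²`: slices, Fubini, continuity of a partial
integral, and the integration by parts `∫₀¹ t g'(t) dt = g(1) − ∫₀¹ g`. -/

/-- Integration by parts against the identity: `∫₀¹ t g'(t) dt = g(1) − ∫₀¹ g(t) dt`. [folklore] -/
private theorem integral_id_mul_deriv {g g' : ℝ → ℝ} (hg : ∀ t ∈ Icc (0 : ℝ) 1, HasDerivAt g (g' t) t)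
    (hg' : ContinuousOn g' (Icc (0 : ℝ) 1)) :
    ∫ t in (0 : ℝ)..1, t * g' t = g 1 - ∫ t in (0 : ℝ)..1, g t := by
  have hg'int : IntervalIntegrable g' volume 0 1 :=
    (hg'.mono (by rw [uIcc_of_le zero_le_one])).intervalIntegrable
  have h := integral_mul_deriv_eq_deriv_mul (u := fun t => t) (u' := fun _ => (1 : ℝ)) (v := g)
    (v' := g') (a := 0) (b := 1) (fun t _ => hasDerivAt_id t)
    (fun t ht => hg t (by rwa [uIcc_of_le zero_le_one] at ht)) intervalIntegrable_const hg'int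
  rw [h]
  simp

variable {G : ℝ → ℝ → ℝ}

/-- A horizontal slice `s ↦ G(s, t)` of a function continuous on `[0,1]²` is continuous on
`[0,1]`. [folklore] -/
private theorem continuousOn_slice_left (hG : ContinuousOn (uncurry G) (Icc (0 : ℝ) 1 ×ˢ Icc (0 : ℝ) 1))
    {t : ℝ} (ht : t ∈ Icc (0 : ℝ) 1) : ContinuousOn (fun s => G s t) (Icc (0 : ℝ) 1) :=
  hG.comp ((continuousOn_id' _).prodMk continuousOn_const) fun _ hs => ⟨hs, ht⟩

/-- A vertical slice `t ↦ G(s, t)` of a function continuous on `[0,1]²` is continuous on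
`[0,1]`. [folklore] -/
private theorem continuousOn_slice_right (hG : ContinuousOn (uncurry G) (Icc (0 : ℝ) 1 ×ˢ Icc (0 : ℝ) 1))
    {s : ℝ} (hs : s ∈ Icc (0 : ℝ) 1) : ContinuousOn (fun t => G s t) (Icc (0 : ℝ) 1) :=
  hG.comp (continuousOn_const.prodMk (continuousOn_id' _)) fun _ ht => ⟨hs, ht⟩

/-- Swapping the arguments preserves continuity on the square. [folklore] -/
private theorem continuousOn_uncurry_swap (hG : ContinuousOn (uncurry G) (Icc (0 : ℝ) 1 ×ˢ Icc (0 : ℝ) 1)) :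
    ContinuousOn (uncurry fun t s => G s t) (Icc (0 : ℝ) 1 ×ˢ Icc (0 : ℝ) 1) :=
  hG.comp continuous_swap.continuousOn fun _ hp => ⟨hp.2, hp.1⟩

/-- Fubini on the unit square for a continuous integrand (interval-integral form). [folklore] -/
private theorem integral_integral_swap_unitSq
    (hG : ContinuousOn (uncurry G) (Icc (0 : ℝ) 1 ×ˢ Icc (0 : ℝ) 1)) :
    ∫ s in (0 : ℝ)..1, ∫ t in (0 : ℝ)..1, G s t = ∫ t in (0 : ℝ)..1, ∫ s in (0 : ℝ)..1, G s t := by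
  have h1 : (fun s => ∫ t in (0 : ℝ)..1, G s t) = fun s => ∫ t in Ioc (0 : ℝ) 1, G s t := by
    funext s; rw [integral_of_le zero_le_one]
  have h2 : (fun t => ∫ s in (0 : ℝ)..1, G s t) = fun t => ∫ s in Ioc (0 : ℝ) 1, G s t := by
    funext t; rw [integral_of_le zero_le_one]
  rw [integral_of_le zero_le_one, integral_of_le zero_le_one, h1, h2]
  refine MeasureTheory.integral_integral_swap ?_
  rw [Measure.prod_restrict, ← Measure.volume_eq_prod]
  exact (hG.integrableOn_compact (isCompact_Icc.prod isCompact_Icc)).mono_set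
    (prod_mono Ioc_subset_Icc_self Ioc_subset_Icc_self)

/-- The partial integral `s ↦ ∫₀¹ G(s, t) dt` of a function continuous on `[0,1]²` is continuous
on `[0,1]` (clamp both variables to `[0,1]` and use continuity of parametric integrals over a
compact set). [folklore] -/
private theorem continuousOn_integral_right
    (hG : ContinuousOn (uncurry G) (Icc (0 : ℝ) 1 ×ˢ Icc (0 : ℝ) 1)) :
    ContinuousOn (fun s => ∫ t in (0 : ℝ)..1, G s t) (Icc (0 : ℝ) 1) := by
  set F : ℝ → ℝ → ℝ := fun s t =>
    G (projIcc 0 1 zero_le_one s : ℝ) (projIcc 0 1 zero_le_one t : ℝ) with hFdef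
  have hF : Continuous (uncurry F) := by
    have h1 : Continuous fun q : ℝ × ℝ =>
        ((projIcc 0 1 zero_le_one q.1 : ℝ), (projIcc 0 1 zero_le_one q.2 : ℝ)) :=
      (continuous_subtype_val.comp (continuous_projIcc.comp continuous_fst)).prodMk
        (continuous_subtype_val.comp (continuous_projIcc.comp continuous_snd))
    exact hG.comp_continuous h1 fun q =>
      mk_mem_prod (projIcc 0 1 zero_le_one q.1).2 (projIcc 0 1 zero_le_one q.2).2
  have hcont : Continuous fun s => ∫ t in Icc (0 : ℝ) 1, F s t :=
    continuous_parametric_integral_of_continuous (μ := (volume : Measure ℝ)) hF isCompact_Icc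
  refine hcont.continuousOn.congr fun s hs => ?_
  dsimp only
  rw [integral_of_le zero_le_one, ← integral_Icc_eq_integral_Ioc]
  refine setIntegral_congr_fun measurableSet_Icc fun t ht => ?_
  simp only [hFdef, projIcc_of_mem zero_le_one hs, projIcc_of_mem zero_le_one ht]

/-- The partial integral `t ↦ ∫₀¹ G(s, t) ds` is continuous on `[0,1]`. [folklore] -/
private theorem continuousOn_integral_left
    (hG : ContinuousOn (uncurry G) (Icc (0 : ℝ) 1 ×ˢ Icc (0 : ℝ) 1)) :
    ContinuousOn (fun t => ∫ s in (0 : ℝ)..1, G s t) (Icc (0 : ℝ) 1) :=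
  continuousOn_integral_right (continuousOn_uncurry_swap hG)

/-! ### Hlawka's identity and the Koksma–Hlawka inequality, `s = 2` -/

section Smooth

variable {x y}
variable {f f₁ f₁₂ : ℝ → ℝ → ℝ} {f₂ : ℝ → ℝ}

/-- The inner integral of the interior term in closed form: for `s ∈ [0,1]`,
`∫₀¹ Δ(s,t) f₁₂(s,t) dt = (1/N) Σ_n 1[x_n < s] (f₁(s,1) − f₁(s,y_n)) − s (f₁(s,1) − ∫₀¹ f₁(s,t) dt)`
(fundamental theorem of calculus in `t` on `[y_n, 1]`, and one integration by parts). [folklore] -/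
private theorem integral_delta₂_mul (hy0 : ∀ n, 0 ≤ y n) (hy1 : ∀ n, y n < 1)
    (hf₁₂ : ContinuousOn (uncurry f₁₂) (Icc (0 : ℝ) 1 ×ˢ Icc (0 : ℝ) 1))
    (hd₁₂ : ∀ s ∈ Icc (0 : ℝ) 1, ∀ t ∈ Icc (0 : ℝ) 1, HasDerivAt (fun u => f₁ s u) (f₁₂ s t) t)
    {s : ℝ} (hs : s ∈ Icc (0 : ℝ) 1) :
    ∫ t in (0 : ℝ)..1, delta₂ x y s t * f₁₂ s t =
      (∑ n, (if x n < s then (1 : ℝ) else 0) * (f₁ s 1 - f₁ s (y n))) / N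
        - s * (f₁ s 1 - ∫ t in (0 : ℝ)..1, f₁ s t) := by
  have hg' : ContinuousOn (fun t => f₁₂ s t) (Icc (0 : ℝ) 1) := continuousOn_slice_right hf₁₂ hs
  have hg'u : ContinuousOn (fun t => f₁₂ s t) (uIcc (0 : ℝ) 1) := by
    rwa [uIcc_of_le zero_le_one]
  have hpt : EqOn (fun t => delta₂ x y s t * f₁₂ s t)
      (fun t => (∑ n, (if x n < s then (1 : ℝ) else 0) *
          ((if y n < t then (1 : ℝ) else 0) * f₁₂ s t)) / N - s * (t * f₁₂ s t)) (uIcc 0 1) := by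
    intro t _
    simp only
    rw [delta₂_eq_sum, sub_mul, Finset.sum_div, Finset.sum_mul, Finset.sum_div]
    congr 1
    · exact Finset.sum_congr rfl fun n _ => by ring
    · ring
  have hint1 : ∀ n, IntervalIntegrable
      (fun t => (if y n < t then (1 : ℝ) else 0) * f₁₂ s t) volume 0 1 :=
    fun n => intervalIntegrable_ind_mul hg' (y n) le_rfl zero_le_one le_rfl
  have hintS : IntervalIntegrable (fun t => ∑ n, (if x n < s then (1 : ℝ) else 0) *
      ((if y n < t then (1 : ℝ) else 0) * f₁₂ s t)) volume 0 1 := by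
    have := IntervalIntegrable.sum Finset.univ fun n (_ : n ∈ Finset.univ) =>
      (hint1 n).const_mul (if x n < s then (1 : ℝ) else 0)
    exact this.congr fun t _ => Finset.sum_apply t _ _
  have hintT : IntervalIntegrable (fun t => t * f₁₂ s t) volume 0 1 :=
    intervalIntegral.intervalIntegrable_id.mul_continuousOn hg'u
  rw [integral_congr hpt, integral_sub (hintS.div_const _) (hintT.const_mul s),
    intervalIntegral.integral_div, integral_finsetSum fun n _ => (hint1 n).const_mul _]
  simp_rw [intervalIntegral.integral_const_mul,
    integral_indicator_mul_deriv (hd₁₂ s hs) hg' (hy0 _) (hy1 _)]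
  rw [integral_id_mul_deriv (hd₁₂ s hs) hg']

/-- **Hlawka's identity (Zaremba's identity) in dimension two**
[cite: DickPillichshammer2010, Prop. 2.17 (`s = 2`)]: for points `(x_n, y_n) ∈ [0,1)²` and `f`
with continuous partials `f₁ = ∂f/∂s`, `f₂ = (∂f/∂t)(1, ·)`, `f₁₂ = ∂²f/∂t∂s` on `[0,1]²`,
`(1/N) Σ_n f(x_n, y_n) − ∫₀¹∫₀¹ f
   = −∫₀¹ Δ(s,1) f₁(s,1) ds − ∫₀¹ Δ(1,t) f₂(t) dt + ∫₀¹∫₀¹ Δ(s,t) f₁₂(s,t) dt ds`,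
where `Δ(s,1) = Discrepancy.delta x s` and `Δ(1,t) = Discrepancy.delta y t` are the
one-dimensional local discrepancies of the two coordinate families.
[cite: DickPillichshammer2010, Prop. 2.17] -/
theorem hlawka_zaremba_identity₂ (hN : 0 < N) (hx0 : ∀ n, 0 ≤ x n) (hx1 : ∀ n, x n < 1)
    (hy0 : ∀ n, 0 ≤ y n) (hy1 : ∀ n, y n < 1)
    (hf : ContinuousOn (uncurry f) (Icc (0 : ℝ) 1 ×ˢ Icc (0 : ℝ) 1))
    (hf₁ : ContinuousOn (uncurry f₁) (Icc (0 : ℝ) 1 ×ˢ Icc (0 : ℝ) 1))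
    (hf₁₂ : ContinuousOn (uncurry f₁₂) (Icc (0 : ℝ) 1 ×ˢ Icc (0 : ℝ) 1))
    (hf₂ : ContinuousOn f₂ (Icc (0 : ℝ) 1))
    (hd₁ : ∀ s ∈ Icc (0 : ℝ) 1, ∀ t ∈ Icc (0 : ℝ) 1, HasDerivAt (fun u => f u t) (f₁ s t) s)
    (hd₂ : ∀ t ∈ Icc (0 : ℝ) 1, HasDerivAt (fun u => f 1 u) (f₂ t) t)
    (hd₁₂ : ∀ s ∈ Icc (0 : ℝ) 1, ∀ t ∈ Icc (0 : ℝ) 1, HasDerivAt (fun u => f₁ s u) (f₁₂ s t) t) :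
    (∑ n, f (x n) (y n)) / N - ∫ s in (0 : ℝ)..1, ∫ t in (0 : ℝ)..1, f s t =
      -(∫ s in (0 : ℝ)..1, delta x s * f₁ s 1) - (∫ t in (0 : ℝ)..1, delta y t * f₂ t)
        + ∫ s in (0 : ℝ)..1, ∫ t in (0 : ℝ)..1, delta₂ x y s t * f₁₂ s t := by
  have hNr : (N : ℝ) ≠ 0 := by exact_mod_cast hN.ne'
  have h1 : (1 : ℝ) ∈ Icc (0 : ℝ) 1 := ⟨zero_le_one, le_rfl⟩
  have hI01 : uIcc (0 : ℝ) 1 = Icc 0 1 := uIcc_of_le zero_le_one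
  -- the two edge terms are one-dimensional identities (`integral_delta_mul_deriv`)
  have hE₁ : ∫ s in (0 : ℝ)..1, delta x s * f₁ s 1 =
      (∫ s in (0 : ℝ)..1, f s 1) - (∑ n, f (x n) 1) / N :=
    integral_delta_mul_deriv hN hx0 hx1 (g := fun u => f u 1) (fun s hs => hd₁ s hs 1 h1)
      (continuousOn_slice_left hf₁ h1)
  have hE₂ : ∫ t in (0 : ℝ)..1, delta y t * f₂ t =
      (∫ t in (0 : ℝ)..1, f 1 t) - (∑ n, f 1 (y n)) / N :=
    integral_delta_mul_deriv hN hy0 hy1 hd₂ hf₂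
  -- the interior term: inner integral in closed form, then integrate in `s`
  have hint1 : ∀ n, IntervalIntegrable
      (fun s => (if x n < s then (1 : ℝ) else 0) * (f₁ s 1 - f₁ s (y n))) volume 0 1 :=
    fun n => intervalIntegrable_ind_mul ((continuousOn_slice_left hf₁ h1).sub
      (continuousOn_slice_left hf₁ ⟨hy0 n, (hy1 n).le⟩)) (x n) le_rfl zero_le_one le_rfl
  have hintS : IntervalIntegrable
      (fun s => ∑ n, (if x n < s then (1 : ℝ) else 0) * (f₁ s 1 - f₁ s (y n))) volume 0 1 := by
    have := IntervalIntegrable.sum Finset.univ fun n (_ : n ∈ Finset.univ) => hint1 n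
    exact this.congr fun t _ => Finset.sum_apply t _ _
  have hF₁ : ContinuousOn (fun s => ∫ t in (0 : ℝ)..1, f₁ s t) (Icc (0 : ℝ) 1) :=
    continuousOn_integral_right hf₁
  have hcA : ContinuousOn (fun s => s * f₁ s 1) (uIcc (0 : ℝ) 1) := by
    rw [hI01]; exact (continuousOn_id' _).mul (continuousOn_slice_left hf₁ h1)
  have hcB : ContinuousOn (fun s => s * ∫ t in (0 : ℝ)..1, f₁ s t) (uIcc (0 : ℝ) 1) := by
    rw [hI01]; exact (continuousOn_id' _).mul hF₁
  have hA : ∫ s in (0 : ℝ)..1, ∑ n, (if x n < s then (1 : ℝ) else 0) * (f₁ s 1 - f₁ s (y n)) =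
      ∑ n, ((f 1 1 - f 1 (y n)) - (f (x n) 1 - f (x n) (y n))) := by
    rw [integral_finsetSum fun n _ => hint1 n]
    refine Finset.sum_congr rfl fun n _ => ?_
    rw [integral_indicator_mul_deriv (g := fun u => f u 1 - f u (y n))
      (fun s hs => (hd₁ s hs 1 h1).sub (hd₁ s hs (y n) ⟨hy0 n, (hy1 n).le⟩))
      ((continuousOn_slice_left hf₁ h1).sub (continuousOn_slice_left hf₁ ⟨hy0 n, (hy1 n).le⟩))
      (hx0 n) (hx1 n)]
  have hB₁ : ∫ s in (0 : ℝ)..1, s * f₁ s 1 = f 1 1 - ∫ s in (0 : ℝ)..1, f s 1 :=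
    integral_id_mul_deriv (g := fun u => f u 1) (fun s hs => hd₁ s hs 1 h1)
      (continuousOn_slice_left hf₁ h1)
  have hswap : ∫ s in (0 : ℝ)..1, s * ∫ t in (0 : ℝ)..1, f₁ s t =
      ∫ t in (0 : ℝ)..1, ∫ s in (0 : ℝ)..1, s * f₁ s t := by
    have hG : ContinuousOn (uncurry fun s t => s * f₁ s t) (Icc (0 : ℝ) 1 ×ˢ Icc (0 : ℝ) 1) :=
      (continuous_fst.continuousOn).mul hf₁
    rw [← integral_integral_swap_unitSq hG]
    exact integral_congr fun s _ => (intervalIntegral.integral_const_mul s _).symm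
  have hB₂ : ∫ t in (0 : ℝ)..1, ∫ s in (0 : ℝ)..1, s * f₁ s t =
      (∫ t in (0 : ℝ)..1, f 1 t) - ∫ t in (0 : ℝ)..1, ∫ s in (0 : ℝ)..1, f s t := by
    have hc1 : ContinuousOn (fun t => f 1 t) (uIcc (0 : ℝ) 1) := by
      rw [hI01]; exact continuousOn_slice_right hf h1
    have hc2 : ContinuousOn (fun t => ∫ s in (0 : ℝ)..1, f s t) (uIcc (0 : ℝ) 1) := by
      rw [hI01]; exact continuousOn_integral_left hf
    rw [← integral_sub hc1.intervalIntegrable hc2.intervalIntegrable]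
    refine integral_congr fun t ht => ?_
    rw [hI01] at ht
    exact integral_id_mul_deriv (g := fun u => f u t) (fun s hs => hd₁ s hs t ht)
      (continuousOn_slice_left hf₁ ht)
  have hB₃ : ∫ t in (0 : ℝ)..1, f 1 t = f 1 1 - ∫ t in (0 : ℝ)..1, t * f₂ t := by
    rw [integral_id_mul_deriv hd₂ hf₂]; ring
  have hB₄ : ∫ t in (0 : ℝ)..1, ∫ s in (0 : ℝ)..1, f s t = ∫ s in (0 : ℝ)..1, ∫ t in (0 : ℝ)..1, f s t :=
    (integral_integral_swap_unitSq hf).symm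
  have hI : ∫ s in (0 : ℝ)..1, ∫ t in (0 : ℝ)..1, delta₂ x y s t * f₁₂ s t =
      (∑ n, ((f 1 1 - f 1 (y n)) - (f (x n) 1 - f (x n) (y n)))) / N
        - ((f 1 1 - ∫ s in (0 : ℝ)..1, f s 1)
          - ((∫ t in (0 : ℝ)..1, f 1 t) - ∫ s in (0 : ℝ)..1, ∫ t in (0 : ℝ)..1, f s t)) := by
    rw [integral_congr fun s hs => integral_delta₂_mul hy0 hy1 hf₁₂ hd₁₂ (by rwa [hI01] at hs),
      integral_sub (hintS.div_const _) (hcA.intervalIntegrable.sub hcB.intervalIntegrable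
        |>.congr fun s _ => (mul_sub s _ _).symm),
      intervalIntegral.integral_div, hA]
    simp_rw [mul_sub]
    rw [integral_sub hcA.intervalIntegrable hcB.intervalIntegrable, hB₁, hswap, hB₂, hB₄]
  -- assemble
  have hS : (∑ n, ((f 1 1 - f 1 (y n)) - (f (x n) 1 - f (x n) (y n)))) / N =
      f 1 1 - (∑ n, f 1 (y n)) / N - (∑ n, f (x n) 1) / N + (∑ n, f (x n) (y n)) / N := by
    simp only [Finset.sum_sub_distrib, Finset.sum_const, Finset.card_univ, Fintype.card_fin,
      nsmul_eq_mul]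
    field_simp
    ring
  rw [hE₁, hE₂, hI, hS]
  ring

/-- **The Koksma–Hlawka inequality in dimension two** [cite: DickPillichshammer2010, Prop. 2.18
(`s = 2`)] = Hlawka's theorem [cite: Niederreiter1992, Thm 2.11 with eq. (2.5)] for integrands with
continuous mixed partials: if `|Δ(s, t)| ≤ D` on `[0,1]²` then
`|(1/N) Σ_n f(x_n, y_n) − ∫₀¹∫₀¹ f| ≤ D · (∫₀¹ |f₁(s,1)| ds + ∫₀¹ |f₂(t)| dt + ∫₀¹∫₀¹ |f₁₂(s,t)| dt ds)`,
the bracket being the Hardy–Krause variation `V(f)` of such an `f`.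
[cite: DickPillichshammer2010, Prop. 2.18; Niederreiter1992, Thm 2.11] -/
theorem koksma_hlawka₂ (hN : 0 < N) (hx0 : ∀ n, 0 ≤ x n) (hx1 : ∀ n, x n < 1)
    (hy0 : ∀ n, 0 ≤ y n) (hy1 : ∀ n, y n < 1)
    (hf : ContinuousOn (uncurry f) (Icc (0 : ℝ) 1 ×ˢ Icc (0 : ℝ) 1))
    (hf₁ : ContinuousOn (uncurry f₁) (Icc (0 : ℝ) 1 ×ˢ Icc (0 : ℝ) 1))
    (hf₁₂ : ContinuousOn (uncurry f₁₂) (Icc (0 : ℝ) 1 ×ˢ Icc (0 : ℝ) 1))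
    (hf₂ : ContinuousOn f₂ (Icc (0 : ℝ) 1))
    (hd₁ : ∀ s ∈ Icc (0 : ℝ) 1, ∀ t ∈ Icc (0 : ℝ) 1, HasDerivAt (fun u => f u t) (f₁ s t) s)
    (hd₂ : ∀ t ∈ Icc (0 : ℝ) 1, HasDerivAt (fun u => f 1 u) (f₂ t) t)
    (hd₁₂ : ∀ s ∈ Icc (0 : ℝ) 1, ∀ t ∈ Icc (0 : ℝ) 1, HasDerivAt (fun u => f₁ s u) (f₁₂ s t) t)
    {D : ℝ} (hD : ∀ s ∈ Icc (0 : ℝ) 1, ∀ t ∈ Icc (0 : ℝ) 1, |delta₂ x y s t| ≤ D) :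
    |(∑ n, f (x n) (y n)) / N - ∫ s in (0 : ℝ)..1, ∫ t in (0 : ℝ)..1, f s t| ≤
      D * ((∫ s in (0 : ℝ)..1, |f₁ s 1|) + (∫ t in (0 : ℝ)..1, |f₂ t|)
        + ∫ s in (0 : ℝ)..1, ∫ t in (0 : ℝ)..1, |f₁₂ s t|) := by
  have h1 : (1 : ℝ) ∈ Icc (0 : ℝ) 1 := ⟨zero_le_one, le_rfl⟩
  have hI01 : uIcc (0 : ℝ) 1 = Icc 0 1 := uIcc_of_le zero_le_one
  rw [hlawka_zaremba_identity₂ hN hx0 hx1 hy0 hy1 hf hf₁ hf₁₂ hf₂ hd₁ hd₂ hd₁₂]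
  -- `|Δ| ≤ D` on the two edges
  have hDx : ∀ s ∈ Icc (0 : ℝ) 1, |delta x s| ≤ D := fun s hs => by
    rw [← delta₂_one_right hy1 x s]; exact hD s hs 1 h1
  have hDy : ∀ t ∈ Icc (0 : ℝ) 1, |delta y t| ≤ D := fun t ht => by
    rw [← delta₂_one_left hx1 y t]; exact hD 1 h1 t ht
  -- edge term in `s`
  have hc₁ : ContinuousOn (fun s => f₁ s 1) (uIcc (0 : ℝ) 1) := by
    rw [hI01]; exact continuousOn_slice_left hf₁ h1
  have hT₁ : |∫ s in (0 : ℝ)..1, delta x s * f₁ s 1| ≤ D * ∫ s in (0 : ℝ)..1, |f₁ s 1| := by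
    rw [← intervalIntegral.integral_const_mul]
    calc |∫ s in (0 : ℝ)..1, delta x s * f₁ s 1| ≤ ∫ s in (0 : ℝ)..1, |delta x s * f₁ s 1| :=
          abs_integral_le_integral_abs zero_le_one
      _ ≤ ∫ s in (0 : ℝ)..1, D * |f₁ s 1| :=
          integral_mono_on zero_le_one ((intervalIntegrable_delta hN hx0 hx1).mul_continuousOn hc₁).abs
            (hc₁.abs.intervalIntegrable.const_mul _) fun s hs => by
            rw [abs_mul]; exact mul_le_mul_of_nonneg_right (hDx s hs) (abs_nonneg _)
  -- edge term in `t`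
  have hc₂ : ContinuousOn f₂ (uIcc (0 : ℝ) 1) := by rwa [hI01]
  have hT₂ : |∫ t in (0 : ℝ)..1, delta y t * f₂ t| ≤ D * ∫ t in (0 : ℝ)..1, |f₂ t| := by
    rw [← intervalIntegral.integral_const_mul]
    calc |∫ t in (0 : ℝ)..1, delta y t * f₂ t| ≤ ∫ t in (0 : ℝ)..1, |delta y t * f₂ t| :=
          abs_integral_le_integral_abs zero_le_one
      _ ≤ ∫ t in (0 : ℝ)..1, D * |f₂ t| :=
          integral_mono_on zero_le_one ((intervalIntegrable_delta hN hy0 hy1).mul_continuousOn hc₂).abs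
            (hc₂.abs.intervalIntegrable.const_mul _) fun t ht => by
            rw [abs_mul]; exact mul_le_mul_of_nonneg_right (hDy t ht) (abs_nonneg _)
  -- interior term
  have hinner : ∀ s ∈ Icc (0 : ℝ) 1,
      |∫ t in (0 : ℝ)..1, delta₂ x y s t * f₁₂ s t| ≤ D * ∫ t in (0 : ℝ)..1, |f₁₂ s t| := by
    intro s hs
    have hc : ContinuousOn (fun t => f₁₂ s t) (uIcc (0 : ℝ) 1) := by
      rw [hI01]; exact continuousOn_slice_right hf₁₂ hs
    rw [← intervalIntegral.integral_const_mul]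
    calc |∫ t in (0 : ℝ)..1, delta₂ x y s t * f₁₂ s t|
          ≤ ∫ t in (0 : ℝ)..1, |delta₂ x y s t * f₁₂ s t| := abs_integral_le_integral_abs zero_le_one
      _ ≤ ∫ t in (0 : ℝ)..1, D * |f₁₂ s t| :=
          integral_mono_on zero_le_one ((intervalIntegrable_delta₂_right x y s).mul_continuousOn hc).abs
            (hc.abs.intervalIntegrable.const_mul _) fun t ht => by
            rw [abs_mul]; exact mul_le_mul_of_nonneg_right (hD s hs t ht) (abs_nonneg _)
  -- the outer integrand `s ↦ ∫₀¹ Δ f₁₂ dt` is integrable: it has a closed form on `[0,1]`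
  have hcl : IntervalIntegrable (fun s => (∑ n, (if x n < s then (1 : ℝ) else 0) *
      (f₁ s 1 - f₁ s (y n))) / N - s * (f₁ s 1 - ∫ t in (0 : ℝ)..1, f₁ s t)) volume 0 1 := by
    refine IntervalIntegrable.sub (IntervalIntegrable.div_const ?_ _) ?_
    · have := IntervalIntegrable.sum Finset.univ fun n (_ : n ∈ Finset.univ) =>
        intervalIntegrable_ind_mul ((continuousOn_slice_left hf₁ h1).sub
          (continuousOn_slice_left hf₁ ⟨hy0 n, (hy1 n).le⟩)) (x n) le_rfl zero_le_one le_rfl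
      exact this.congr fun t _ => Finset.sum_apply t _ _
    · have hc : ContinuousOn (fun s => s * (f₁ s 1 - ∫ t in (0 : ℝ)..1, f₁ s t)) (uIcc (0 : ℝ) 1) := by
        rw [hI01]
        exact (continuousOn_id' _).mul ((continuousOn_slice_left hf₁ h1).sub
          (continuousOn_integral_right hf₁))
      exact hc.intervalIntegrable
  have hOut : IntervalIntegrable
      (fun s => ∫ t in (0 : ℝ)..1, delta₂ x y s t * f₁₂ s t) volume 0 1 := by
    refine hcl.congr fun s hs => ?_
    rw [uIoc_of_le zero_le_one] at hs
    exact (integral_delta₂_mul hy0 hy1 hf₁₂ hd₁₂ (Ioc_subset_Icc_self hs)).symm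
  have hcAbs : ContinuousOn (fun s => ∫ t in (0 : ℝ)..1, |f₁₂ s t|) (uIcc (0 : ℝ) 1) := by
    rw [hI01]
    exact continuousOn_integral_right (G := fun s t => |f₁₂ s t|) hf₁₂.abs
  have hT₁₂ : |∫ s in (0 : ℝ)..1, ∫ t in (0 : ℝ)..1, delta₂ x y s t * f₁₂ s t| ≤
      D * ∫ s in (0 : ℝ)..1, ∫ t in (0 : ℝ)..1, |f₁₂ s t| := by
    rw [← intervalIntegral.integral_const_mul]
    calc |∫ s in (0 : ℝ)..1, ∫ t in (0 : ℝ)..1, delta₂ x y s t * f₁₂ s t|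
          ≤ ∫ s in (0 : ℝ)..1, |∫ t in (0 : ℝ)..1, delta₂ x y s t * f₁₂ s t| :=
          abs_integral_le_integral_abs zero_le_one
      _ ≤ ∫ s in (0 : ℝ)..1, D * ∫ t in (0 : ℝ)..1, |f₁₂ s t| :=
          integral_mono_on zero_le_one hOut.abs (hcAbs.intervalIntegrable.const_mul _)
            fun s hs => by rw [hI01.symm.trans (uIcc_of_le zero_le_one)] at hs; exact hinner s hs
  -- triangle inequality
  have habs : |-(∫ s in (0 : ℝ)..1, delta x s * f₁ s 1) - (∫ t in (0 : ℝ)..1, delta y t * f₂ t)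
      + ∫ s in (0 : ℝ)..1, ∫ t in (0 : ℝ)..1, delta₂ x y s t * f₁₂ s t| ≤
      |∫ s in (0 : ℝ)..1, delta x s * f₁ s 1| + |∫ t in (0 : ℝ)..1, delta y t * f₂ t|
        + |∫ s in (0 : ℝ)..1, ∫ t in (0 : ℝ)..1, delta₂ x y s t * f₁₂ s t| := by
    rw [abs_le]
    constructor <;> nlinarith [le_abs_self (∫ s in (0 : ℝ)..1, delta x s * f₁ s 1),
      neg_abs_le (∫ s in (0 : ℝ)..1, delta x s * f₁ s 1),
      le_abs_self (∫ t in (0 : ℝ)..1, delta y t * f₂ t), neg_abs_le (∫ t in (0 : ℝ)..1, delta y t * f₂ t),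
      le_abs_self (∫ s in (0 : ℝ)..1, ∫ t in (0 : ℝ)..1, delta₂ x y s t * f₁₂ s t),
      neg_abs_le (∫ s in (0 : ℝ)..1, ∫ t in (0 : ℝ)..1, delta₂ x y s t * f₁₂ s t)]
  rw [mul_add, mul_add]
  linarith

/-- The Koksma–Hlawka inequality with the star discrepancy `D*_N = sup_{[0,1]²} |Δ|`, the literal
shape of [cite: Niederreiter1992, Thm 2.11] (`s = 2`, integrands with continuous mixed partials,
`V(f)` given by eq. (2.5)). [cite: Niederreiter1992, Thm 2.11; DickPillichshammer2010, Prop. 2.18] -/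
theorem koksma_hlawka₂_starDiscrepancy₂ (hN : 0 < N) (hx0 : ∀ n, 0 ≤ x n) (hx1 : ∀ n, x n < 1)
    (hy0 : ∀ n, 0 ≤ y n) (hy1 : ∀ n, y n < 1)
    (hf : ContinuousOn (uncurry f) (Icc (0 : ℝ) 1 ×ˢ Icc (0 : ℝ) 1))
    (hf₁ : ContinuousOn (uncurry f₁) (Icc (0 : ℝ) 1 ×ˢ Icc (0 : ℝ) 1))
    (hf₁₂ : ContinuousOn (uncurry f₁₂) (Icc (0 : ℝ) 1 ×ˢ Icc (0 : ℝ) 1))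
    (hf₂ : ContinuousOn f₂ (Icc (0 : ℝ) 1))
    (hd₁ : ∀ s ∈ Icc (0 : ℝ) 1, ∀ t ∈ Icc (0 : ℝ) 1, HasDerivAt (fun u => f u t) (f₁ s t) s)
    (hd₂ : ∀ t ∈ Icc (0 : ℝ) 1, HasDerivAt (fun u => f 1 u) (f₂ t) t)
    (hd₁₂ : ∀ s ∈ Icc (0 : ℝ) 1, ∀ t ∈ Icc (0 : ℝ) 1, HasDerivAt (fun u => f₁ s u) (f₁₂ s t) t) :
    |(∑ n, f (x n) (y n)) / N - ∫ s in (0 : ℝ)..1, ∫ t in (0 : ℝ)..1, f s t| ≤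
      starDiscrepancy₂ x y * ((∫ s in (0 : ℝ)..1, |f₁ s 1|) + (∫ t in (0 : ℝ)..1, |f₂ t|)
        + ∫ s in (0 : ℝ)..1, ∫ t in (0 : ℝ)..1, |f₁₂ s t|) :=
  koksma_hlawka₂ hN hx0 hx1 hy0 hy1 hf hf₁ hf₁₂ hf₂ hd₁ hd₂ hd₁₂
    fun _ hs _ ht => abs_delta₂_le_starDiscrepancy₂ x y hs ht

end Smooth

end Discrepancy

end Literature.NumberTheory.DiophantineApproximation
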